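import Literature.MathematicalPhysics.QuantumFieldTheory.Balaban1983to89.B3Eq14AuxFunction
import Literature.MathematicalPhysics.QuantumFieldTheory.Balaban1983to89.B1Ineq233Upper

/-!
# `Balaban1983to89.B3Eq15OneSidedInteraction` — T. Bałaban, *(Higgs)₂,₃ quantum fields in a finite volume. III.
# Renormalization*, Commun. Math. Phys. **88** (1983) 411–445 [Balaban1983Higgs3], Sect. 1 p. 412: the
# `λ′`-derivatives at `λ′ = 0` in the interaction `𝒫^{(k)}` (1.5) of the auxiliary function `E_k` (1.4) are ONE-SIDED —
# what the typed concrete instance `B3Eq14AuxFunction.Data14.interaction15` denotes under Lean's total-function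
# conventions, what the print denotes, and the repaired instance `interaction15R` (theorems + one definition)

statement-level skeleton of published theorems with citation tags; proofs where landed; nothing here is a claim about
the Yang–Mills mass gap

CITATION HEADER (lean-in-tree rule).  lit-balaban TYPED SKELETON, rows `B3.Eq1.4` (the auxiliary function `E_k`;
decl of record `B3Eq14AuxFunction.Data14.auxE`, typer g4 p250365) and `B3.Eq1.5` (the interaction after `k` steps;
generic decl of record r15's `B3Sect1Counterterms.pert15`, CONCRETE INSTANCE `B3Eq14AuxFunction.Data14.interaction15`
= `pert15` of `(e′, λ′) ↦ auxE e′ λ′ A^{(k)} φ`, typer g4); unit `lit-balaban-typer` gen 24 — a SEMANTIC AUDIT of the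
typer's OWN decl of record (the second of this generation, after `B1Eq113OneSidedDerivatives` on row B1.Eq1.13: the
same defect one paper later); no file of another seat is touched, `B3Eq14AuxFunction` itself is unchanged (a new
module, because the bound `B1Ineq233Upper.siteInner_covLaplacianN_le` it needs lives in a module whose root-namespace
carriers would shadow `B3Eq14AuxFunction`'s unqualified `Params`/`VecField`; here every carrier is `HiggsLattice.`-qualified).
THE SOURCE TEXT, p. 412 [PDF 2], verbatim: *"Now we define an auxiliary function
E_k(e′, λ′, Ω, A^{(k)}, φ) = −log[ Π_{j=0}^{k−1} ∫dμ_{C^{(j),L^jη}}(A′_j) T^η_{a_k,L^k,e′g_kA′+A^{(k)}}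
 · [exp( −½⟨φ′, (−Δ^η_{e′g_kA′+A^{(k)}} + m²(L^kε)²)φ′⟩ − λ′λ(L^kε) Σ_{x∈Ω₁} η^d|φ′(x)|⁴
 − ½ Σ_{x∈Ω₁} η^d δm²(e′, g_k, λ′, Ω₁, x)·(L^kε)²|φ′(x)|² − E₁(e′, g_k, λ′, Ω₁) )]], (1.4) … The interaction after k
steps is given by the formula 𝒫^{(k)}(Ω₁, A^{(k)}, φ) = Σ_{1≦α+β≦n̄} (1/(α!β!)) (∂^{β+β}/∂e′^α∂λ′^β
E_k(e′, λ′, Ω, A^{(k)}, φ))|_{e′=λ′=0}. (1.5) ⟦sic: print misprints ∂^{β+β} for ∂^{α+β}; the denominator ∂e′^α∂λ′^β and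
the range 1≦α+β≦n̄ fix the intent, and the decls below read ∂^{α+β}⟧  We will give a graphical description of this
expression, giving vertices and propagators, but at first let us describe how this expression is changed when the
operations in the k + 1 step are being done. […]"*, and p. 413 [PDF 3]: *"Let us begin this description by writing down
all the vertices. The
first two describe self-interaction of scalar fields: −λ(L^kε) Σ_{x∈Ω₁} η^d|φ′(x)|⁴, φ′(x) is a scalar field leg, (1.6)
−½ Σ η^d δm²(x)(L^kε)²|φ′(x)|², δm²(x) is one of the renormalization mass counterterms. (1.7)"*.
RELATION TO THE TREE (nothing restated).  `B3Eq14AuxFunction` (typer g4) types (1.4) WITH BODY: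
`Data14.auxE e′ λ′ A^{(k)} φ = −log ∫ (A′ ↦ rt14 A^{(k)} e′ A′ (density14 A^{(k)} e′ λ′ A′) φ) dfluctFamily`, the
renormalization transformation `rt14 … F φ = ∫ (φ′↾_Ω ↦ kernel14 … φ φ′↾_Ω · F(φ′)) d(φ′↾_Ω)` being a LEBESGUE (Bochner)
integral over the fibre `Ω → ℝ^N` (r14's `B1RT`, fields extended by `0` off `Ω`), the density `density14` the printed
exponential with the term `−λ′·λ(L^kε)·Σ_{x∈Ω₁}η^d|φ′(x)|⁴`; and the concrete (1.5) as `Data14.interaction15 n̄ A^{(k)} φ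
:= B3Sect1Counterterms.pert15 (fun e′ λ′ ↦ auxE e′ λ′ A^{(k)} φ) n̄`, where r15's generic
`pert15 E n̄ = Σ_{(α,β) ∈ idx15 n̄} (α!β!)⁻¹ · iteratedDeriv α (e′ ↦ iteratedDeriv β (λ′ ↦ E e′ λ′) 0) 0` reads the
printed mixed partials as ITERATED TWO-SIDED one-variable derivatives (`iteratedDeriv`).

WHAT THIS MODULE SHOWS (all PROVED; hypotheses: `N ≥ 1` scalar components, a non-degenerate kernel precision
`κ = a_k(L^kη)^{d−2} > 0` — e.g. `a > 0`, `L > 1`, `k ≥ 1`, `prec_pos` —, a positive running quartic coupling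
`λ(L^kε) > 0`, and a site `x₀ ∈ Ω ∩ Ω₁`):
* §1 bounds on the pieces of (1.4): the quadratic form is bounded ABOVE, `⟨φ′,(−Δ^η_{𝒜,Ω} + m²(L^kε)²)φ′⟩ ≤
  (4dη⁻² + |m²|(L^kε)²)·η^dΣ_x|φ′(x)|²` (`siteInner_scalarOp_le`, from the g22 bound
  `B1Ineq233Upper.siteInner_covLaplacianN_le` on the Neumann covariant Laplacian); hence for `λ′ ≤ 0` the density of
  (1.4) is bounded BELOW by `exp((−λ′)λ(L^kε)η^d|φ′(x₀)|⁴ − C₂Σ_x|φ′(x)|² − E₁)` (`density14_ge`); the Gaussian kernel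
  `t(Ω; φ, φ′)` of (I.2.5)/(I.2.10) is bounded BELOW by `c^{|Ω^{(k)}|}·exp(−κΣ_y|φ(y)|²)·exp(−κ|Ω^{(k)}|L^{−2kd}|T|Σ_x|φ′(x)|²)`
  (`kernel14_ge`, via `|(Q_kφ′)(y)| ≤ L^{−kd}Σ_x|φ′(x)|`, `norm_avgQ14_le`, the transports (1.3) being isometries).
* §2 THE LOCATED DEFECT `not_integrable_kernel14_mul_density14`: for a NEGATIVE bookkeeping parameter `λ′ < 0` the
  integrand `t(Ω; φ, φ′)·exp[…](φ′)` of `T^η[Ω, exp[…]](φ)` in (1.4) is NOT integrable over the fibre `φ′↾_Ω`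
  (the quartic `−λ′λ(L^kε)Σ_{x∈Ω₁}η^d|φ′|⁴` is then POSITIVE and beats every Gaussian factor along the `x₀`-fibre;
  an integrable function on `(Ω∖{x₀} → ℝ^N) × ℝ^N` has integrable sections, but the section dominates a positive
  constant on an infinite-measure fibre).  Hence, by the Bochner convention `∫ f = 0` for non-integrable `f` and
  `Real.log 0 = 0`: `rt14 … (density14 … λ′ …) φ = 0` (`rt14_density14_eq_zero_of_neg`) and
  **`auxE e′ λ′ A^{(k)} φ = 0` for every `λ′ < 0`** and every `e′`, `A^{(k)}`, `φ` (`auxE_eq_zero_of_neg`).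
* §3 THE FINDING: a real function vanishing on `(−∞, 0)` has all two-sided `iteratedDeriv n · 0`, `n ≥ 1`, equal to
  `0` ([folklore], private; Lean's `deriv` is `0` at points of non-differentiability, and a differentiable such
  function has derivative `0` by uniqueness within `Iio 0`), so `iteratedDeriv β (λ′ ↦ auxE e′ λ′ A^{(k)} φ) 0 = 0` for
  every `e′` and every `β ≥ 1` (`iteratedDeriv_auxE_lam_eq_zero`); consequently the typed concrete (1.5)
  `Data14.interaction15 n̄ A^{(k)} φ` EQUALS its `β = 0` sub-sum `Σ_{1≤α≤n̄}(α!)⁻¹(∂/∂e′)^α E_k(e′, 0, …)|₀`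
  (`interaction15_eq_sum_beta_zero`): under Lean's conventions NO term of (1.5) with a `λ′`-derivative survives — in
  particular the `φ⁴` vertex (1.6) p. 413, which the print obtains from `∂/∂λ′` of the exponent of (1.4), never occurs
  in the typed `𝒫^{(k)}`.
* §4 WHAT THE PRINT DENOTES is the RIGHT derivative at `λ′ = 0⁺`: (1.5) is a perturbation expansion ("vertices and
  propagators", pp. 412–413), and for `λ′ < 0` the integral (1.4) diverges in print as well; the print never
  differentiates `E_k` at negative `λ′`.  The REPAIRED concrete instance `interaction15R n̄ A^{(k)} φ :=
  Σ_{(α,β) ∈ idx15 n̄} (α!β!)⁻¹ · iteratedDeriv α (e′ ↦ iteratedDerivWithin β (λ′ ↦ auxE e′ λ′ A^{(k)} φ) (Set.Ici 0) 0) 0`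
  (the `λ′`-derivatives WITHIN `[0, ∞)`, the `e′`-derivatives two-sided as printed — for `λ′ ≥ 0` (1.4) converges for
  every real `e′` —, inner variable `λ′`, outer `e′`: the convention of r01's repaired `B1Sect1Statements.ModelData.e1R`
  for the same defect in paper I's (1.13), p331274, and of r12's repaired (I.3.62) `B1Sect3Statements.pertSum362R`,
  p332088), with the dictionary `interaction15R_eq_pertSum362R_sub` (`interaction15R = pertSum362R(E_k) 1 1 n̄ − E_k(0,0)`,
  the analogue of g4's `interaction15_eq` / r15's `pert15_eq_pertSum362_sub` for the two-sided sums),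
  `interaction15R_term_beta_zero` (the `β = 0` terms of the two instances agree; they differ exactly in the `β ≥ 1`
  terms) and `interaction15R_zero` (`n̄ = 0`).
v1.1 (append-only, after r15's `B3Sect1Counterterms` v1.1 p333998 took the owner call and added the generic one-sided
`pert15R`): §5 `interaction15R_eq_pert15R` (`rfl`: `interaction15R` IS `pert15R` at the typed `E_k`),
`interaction15R_congr_Ici` (the repaired instance depends on `E_k` only through `λ′ ≥ 0`),
`interaction15R_eq_interaction15_of_contDiffAt` (agreement with g4's instance under two-sided smoothness — a premise the
audit hypotheses defeat), `interaction15R_sub_interaction15` (under the audit hypotheses the two instances differ by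
exactly the `β ≥ 1` part of the repaired sum); v1.0 declarations byte-identical.
v1.2 (DOCSTRING ONLY, referee ref-1 gen 67–69 F1 ask; renders `1983-cmp88-higgs23-III-p002-x2.png` and `…-p002-x4.png` re-read by
typer g25): the p. 412 quotation above now TRANSCRIBES the print's misprinted numerator «∂^{β+β}» of (1.5) with a ⟦sic⟧ note
(v1.0/v1.1 had silently corrected it to «∂^{α+β}» inside the verbatim marks) and carries the continuation «, but at first
let us describe …» with an explicit ellipsis; every declaration, statement and proof is byte-identical to v1.1.  The
companion `B3Eq14Finite` (typer g25, p336498/p336928/p337530) supplies the CONVERGENT half of this audit: on `λ′ ≥ 0` the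
nested integral of (1.4) is positive and finite, `exp(−E_k)` equals it, and `E_k` is continuous and a priori bounded in
the fields.
HONEST SCOPE.  Nothing of the paper is contradicted, and r15's generic `pert15` (a function of an abstract
`E : ℝ → ℝ → ℝ`) is not wrong in itself — it is the INSTANCE at the Lebesgue-typed `E_k` of (1.4) that loses the
`λ`-vertices, exactly as `ModelData.e1` did for (1.13) (`B1Eq113OneSidedDerivatives`).  What is NOT shown here: that
the one-sided derivatives of `interaction15R` exist (smoothness of `λ′ ↦ E_k` on `[0, ∞)` from the right needs the
moment bounds of the nested fluctuation/renormalization integrals; at the single-integral carrier level of paper I this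
is `B1Eq113OneSidedDerivatives` §4–§5); the degenerate cases `N = 0`, `κ = 0` (e.g. `k = 0`, where Lean's
`B1.aSeq a L 0 = 0`), `λ(L^kε) = 0` or `Ω ∩ Ω₁ = ∅`, in which the quartic of (1.4) is absent from the fibre integral
and the defect does not arise, are not addressed.  Which instance the rows B3.Eq1.4 / B3.Eq1.5 cite is the fold
owner's call (r15; a generic one-sided `pert15R` beside `pert15`, of which `interaction15R` would be the instance, is
r15's to add — here the sum is written out and tied to r12's `pertSum362R` instead).
-/

open _root_.MeasureTheory

namespace Literature.MathematicalPhysics.QuantumFieldTheory.Balaban1983to89.B3Eq15OneSidedInteraction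

open Literature.MathematicalPhysics.QuantumFieldTheory.Balaban1983to89.HiggsLattice
open Literature.MathematicalPhysics.QuantumFieldTheory.Balaban1983to89.HiggsAveraging
open Literature.MathematicalPhysics.QuantumFieldTheory.Balaban1983to89.HiggsCovariance
open Literature.MathematicalPhysics.QuantumFieldTheory.Balaban1983to89.B3MultiscaleFields
open Literature.MathematicalPhysics.QuantumFieldTheory.Balaban1983to89.HiggsFluctMeasure
open Literature.MathematicalPhysics.QuantumFieldTheory.Balaban1983to89.B1RT
open Literature.MathematicalPhysics.QuantumFieldTheory.Balaban1983to89.B3Eq14AuxFunction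
open Set Filter Topology
open scoped BigOperators

-- the carrier names `Params`, `Site`, `PBond`, `VecField`, `ScalarField` are HiggsLattice's throughout (qualified:
-- sibling modules declare homonyms in the enclosing namespace)
variable {P : HiggsLattice.Params} {N : ℕ}

section SemanticAudit

variable {k : ℕ} (D : Data14 P N k)

/-! ## 1. Bounds on the pieces of (1.4): the quadratic form from above, the density and the kernel from below -/

/-- `Σ_x |φ′(x)|²` over ALL sites of the η-lattice (plain sum of squared norms, no weight). [cite: Balaban1983Higgs3, (1.4) p.412] -/
noncomputable def sqSum (φ' : HiggsLattice.ScalarField P 0 N) : ℝ := ∑ x : HiggsLattice.Site P 0, ‖φ' x‖ ^ 2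

/-- `Σ_x |φ′(x)|² ≥ 0`. [cite: Balaban1983Higgs3, (1.4) p.412] -/
theorem sqSum_nonneg (φ' : HiggsLattice.ScalarField P 0 N) : 0 ≤ sqSum φ' :=
  Finset.sum_nonneg fun x _ => sq_nonneg ‖φ' x‖

/-- a single site is dominated by the total: `|φ′(x)|² ≤ Σ_y |φ′(y)|²`. [cite: Balaban1983Higgs3, (1.4) p.412] -/
theorem sq_le_sqSum (φ' : HiggsLattice.ScalarField P 0 N) (x : HiggsLattice.Site P 0) : ‖φ' x‖ ^ 2 ≤ sqSum φ' :=
  Finset.single_le_sum (f := fun y => ‖φ' y‖ ^ 2) (fun _ _ => sq_nonneg _) (Finset.mem_univ x)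

/-- **Upper bound of the quadratic form of (1.4)**: `⟨φ′, (−Δ^η_{𝒜,Ω} + m²(L^kε)²)φ′⟩ ≤ (4dη⁻² + |m²|(L^kε)²)·η^d·Σ_x|φ′(x)|²`
(the Neumann covariant Laplacian is bounded by `4dη⁻²`, `B1Ineq233Upper.siteInner_covLaplacianN_le`).
[cite: Balaban1983Higgs3, (1.4) p.412] -/
theorem siteInner_scalarOp_le (Ak : HiggsLattice.VecField P 0) (e' : ℝ) (A' : (j : Fin k) → HiggsLattice.VecField P j)
    (φ' : HiggsLattice.ScalarField P 0 N) :
    siteInner φ' (D.scalarOp Ak e' A' φ')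
      ≤ (4 * P.d * (P.mesh 0)⁻¹ ^ 2 + |D.m2| * D.ell ^ 2) * (P.mesh 0 ^ P.d * sqSum φ') := by
  have hη : 0 < P.mesh 0 ^ P.d := pow_pos (P.mesh_pos 0) _
  have hself : siteInner φ' φ' = P.mesh 0 ^ P.d * sqSum φ' := by
    rw [HiggsCovariancePos.siteInner_self_eq, sqSum, Finset.mul_sum]
  have h1 := B1Ineq233Upper.siteInner_covLaplacianN_le D.C D.Ω (D.extField Ak e' A') φ'
  have h2 : siteInner φ' (D.scalarOp Ak e' A' φ')
      = siteInner φ' (covLaplacianN D.C D.Ω (D.extField Ak e' A') φ') + D.m2 * D.ell ^ 2 * siteInner φ' φ' := by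
    rw [Data14.scalarOp_eq, LinearMap.add_apply, LinearMap.smul_apply, LinearMap.id_apply]
    unfold siteInner
    rw [Finset.mul_sum, ← Finset.sum_add_distrib]
    refine Finset.sum_congr rfl fun x _ => ?_
    rw [Pi.add_apply, inner_add_right, Pi.smul_apply, inner_smul_right]
    ring
  rw [h2, hself]
  rw [hself] at h1
  have hS0 : 0 ≤ P.mesh 0 ^ P.d * sqSum φ' := mul_nonneg hη.le (sqSum_nonneg φ')
  have h3 : D.m2 * D.ell ^ 2 * (P.mesh 0 ^ P.d * sqSum φ') ≤ |D.m2| * D.ell ^ 2 * (P.mesh 0 ^ P.d * sqSum φ') :=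
    mul_le_mul_of_nonneg_right (mul_le_mul_of_nonneg_right (le_abs_self _) (sq_nonneg _)) hS0
  linarith [h1, h3, hS0]


/-- **Lower bound of the density of (1.4) along a large-field direction.**  For `λ′ ≤ 0`, `λ(L^kε) ≥ 0` and a site
`x₀ ∈ Ω₁`: `density ≥ exp((−λ′)λ(L^kε)η^d|φ′(x₀)|⁴ − C₂·Σ_x|φ′(x)|² − E₁(e′,λ′))` with the explicit
`C₂ = ½(4dη⁻² + |m²|(L^kε)²)η^d + ½η^d(L^kε)²Σ_{x∈Ω₁}|δm²(e′,λ′,x)|` (drop the other quartic terms, bound the quadratic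
form by `siteInner_scalarOp_le` and the counterterm sitewise). [cite: Balaban1983Higgs3, (1.4) p.412] -/
theorem density14_ge (Ak : HiggsLattice.VecField P 0) (e' lam' : ℝ) (A' : (j : Fin k) → HiggsLattice.VecField P j)
    (hlam : lam' ≤ 0) (hrun : 0 ≤ D.lamRun) {x₀ : HiggsLattice.Site P 0} (hx₀ : x₀ ∈ D.Ω₁)
    (φ' : HiggsLattice.ScalarField P 0 N) :
    Real.exp ((-lam') * D.lamRun * P.mesh 0 ^ P.d * ‖φ' x₀‖ ^ 4
        - (((4 * P.d * (P.mesh 0)⁻¹ ^ 2 + |D.m2| * D.ell ^ 2) * P.mesh 0 ^ P.d) / 2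
            + (P.mesh 0 ^ P.d * D.ell ^ 2 * ∑ x ∈ D.Ω₁, |D.dm2 e' lam' x|) / 2) * sqSum φ'
        - D.E1 e' lam')
      ≤ D.density14 Ak e' lam' A' φ' := by
  have hη : 0 < P.mesh 0 ^ P.d := pow_pos (P.mesh_pos 0) _
  rw [Data14.density14_eq, Real.exp_le_exp]
  have h1 := siteInner_scalarOp_le D Ak e' A' φ'
  -- the quartic term: keep only `x₀`
  have h2 : P.mesh 0 ^ P.d * ‖φ' x₀‖ ^ 4 ≤ ∑ x ∈ D.Ω₁, P.mesh 0 ^ P.d * ‖φ' x‖ ^ 4 :=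
    Finset.single_le_sum (f := fun x => P.mesh 0 ^ P.d * ‖φ' x‖ ^ 4)
      (fun x _ => mul_nonneg hη.le (pow_nonneg (norm_nonneg _) _)) hx₀
  have h2' : (-lam') * D.lamRun * (P.mesh 0 ^ P.d * ‖φ' x₀‖ ^ 4)
      ≤ (-lam') * D.lamRun * ∑ x ∈ D.Ω₁, P.mesh 0 ^ P.d * ‖φ' x‖ ^ 4 :=
    mul_le_mul_of_nonneg_left h2 (mul_nonneg (neg_nonneg.2 hlam) hrun)
  -- the counterterm: sitewise `δm²(x)|φ′(x)|² ≤ |δm²(x)|·Σ|φ′|²`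
  have h3 : ∑ x ∈ D.Ω₁, P.mesh 0 ^ P.d * D.dm2 e' lam' x * D.ell ^ 2 * ‖φ' x‖ ^ 2
      ≤ (P.mesh 0 ^ P.d * D.ell ^ 2 * ∑ x ∈ D.Ω₁, |D.dm2 e' lam' x|) * sqSum φ' := by
    rw [Finset.mul_sum, Finset.sum_mul]
    refine Finset.sum_le_sum fun x _ => ?_
    have ha : D.dm2 e' lam' x * ‖φ' x‖ ^ 2 ≤ |D.dm2 e' lam' x| * sqSum φ' :=
      (mul_le_mul_of_nonneg_right (le_abs_self _) (sq_nonneg _)).trans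
        (mul_le_mul_of_nonneg_left (sq_le_sqSum φ' x) (abs_nonneg _))
    have := mul_le_mul_of_nonneg_left ha (mul_nonneg hη.le (sq_nonneg D.ell))
    calc P.mesh 0 ^ P.d * D.dm2 e' lam' x * D.ell ^ 2 * ‖φ' x‖ ^ 2
        = P.mesh 0 ^ P.d * D.ell ^ 2 * (D.dm2 e' lam' x * ‖φ' x‖ ^ 2) := by ring
      _ ≤ P.mesh 0 ^ P.d * D.ell ^ 2 * (|D.dm2 e' lam' x| * sqSum φ') := this
      _ = P.mesh 0 ^ P.d * D.ell ^ 2 * |D.dm2 e' lam' x| * sqSum φ' := by ring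
  nlinarith [h1, h2', h3, sqSum_nonneg φ']

/-- complete the square: `c r⁴ − C r² ≥ −C²/(4c)` for `c > 0`. [folklore] -/
private theorem quartic_lower' {c : ℝ} (hc : 0 < c) (C r : ℝ) : -(C ^ 2 / (4 * c)) ≤ c * r ^ 4 - C * r ^ 2 := by
  have hne : c ≠ 0 := hc.ne'
  have h : c * r ^ 4 - C * r ^ 2 + C ^ 2 / (4 * c) = (c * r ^ 2 - C / 2) ^ 2 / c := by
    field_simp
    ring
  have h' : 0 ≤ (c * r ^ 2 - C / 2) ^ 2 / c := by positivity
  linarith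

/-- The block average is bounded by the total field: `|(Q_k φ′)(y)| ≤ L^{−kd}Σ_x|φ′(x)|` (the transports of (1.3) are
isometries). [cite: Balaban1983Higgs3, (1.3)–(1.4) p.412] -/
theorem norm_avgQ14_le (Ak : HiggsLattice.VecField P 0) (e' : ℝ) (A' : (j : Fin k) → HiggsLattice.VecField P j)
    (φ' : HiggsLattice.ScalarField P 0 N) (y : HiggsLattice.Site P k) :
    ‖D.avgQ14 Ak e' A' φ' y‖ ≤ ((P.L : ℝ) ^ (k * P.d))⁻¹ * ∑ x : HiggsLattice.Site P 0, ‖φ' x‖ := by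
  rw [Data14.avgQ14_apply, norm_smul, Real.norm_eq_abs, abs_of_nonneg (inv_nonneg.2 (pow_nonneg (Nat.cast_nonneg _) _))]
  refine mul_le_mul_of_nonneg_left ?_ (inv_nonneg.2 (pow_nonneg (Nat.cast_nonneg _) _))
  calc ‖∑ x ∈ blockK k y, holK13 D.C k (D.extPieces e' A') Ak x (φ' x)‖
      ≤ ∑ x ∈ blockK k y, ‖holK13 D.C k (D.extPieces e' A') Ak x (φ' x)‖ := norm_sum_le _ _
    _ = ∑ x ∈ blockK k y, ‖φ' x‖ := Finset.sum_congr rfl fun x _ => by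
        unfold holK13
        exact ContinuousLinearMap.norm_map_of_mem_unitary (D.C.U_mem_unitary _ _) _
    _ ≤ ∑ x : HiggsLattice.Site P 0, ‖φ' x‖ :=
        Finset.sum_le_sum_of_subset_of_nonneg (Finset.subset_univ _) fun x _ _ => norm_nonneg _

/-- … hence `|(Q_k φ′)(y)|² ≤ L^{−2kd}·|T|·Σ_x|φ′(x)|²` (Cauchy–Schwarz). [cite: Balaban1983Higgs3, (1.4) p.412] -/
theorem norm_avgQ14_sq_le (Ak : HiggsLattice.VecField P 0) (e' : ℝ) (A' : (j : Fin k) → HiggsLattice.VecField P j)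
    (φ' : HiggsLattice.ScalarField P 0 N) (y : HiggsLattice.Site P k) :
    ‖D.avgQ14 Ak e' A' φ' y‖ ^ 2
      ≤ (((P.L : ℝ) ^ (k * P.d))⁻¹) ^ 2 * (Fintype.card (HiggsLattice.Site P 0) * sqSum φ') := by
  have h := norm_avgQ14_le D Ak e' A' φ' y
  have hcs : (∑ x : HiggsLattice.Site P 0, ‖φ' x‖) ^ 2 ≤ Fintype.card (HiggsLattice.Site P 0) * sqSum φ' := by
    have := sq_sum_le_card_mul_sum_sq (s := (Finset.univ : Finset (HiggsLattice.Site P 0))) (f := fun x => ‖φ' x‖)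
    simpa [sqSum, Finset.card_univ] using this
  calc ‖D.avgQ14 Ak e' A' φ' y‖ ^ 2 ≤ (((P.L : ℝ) ^ (k * P.d))⁻¹ * ∑ x : HiggsLattice.Site P 0, ‖φ' x‖) ^ 2 :=
        pow_le_pow_left₀ (norm_nonneg _) h 2
    _ = (((P.L : ℝ) ^ (k * P.d))⁻¹) ^ 2 * (∑ x : HiggsLattice.Site P 0, ‖φ' x‖) ^ 2 := by ring
    _ ≤ (((P.L : ℝ) ^ (k * P.d))⁻¹) ^ 2 * (Fintype.card (HiggsLattice.Site P 0) * sqSum φ') :=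
        mul_le_mul_of_nonneg_left hcs (sq_nonneg _)

/-- **Lower bound of the Gaussian kernel of (1.4)** for a non-degenerate precision `κ = a_k(L^kη)^{d−2} > 0`:
`t(Ω; φ, φ′) ≥ (κ/2π)^{N|Ω^{(k)}|/2}·exp(−κΣ_y|φ(y)|²)·exp(−κ|Ω^{(k)}|L^{−2kd}|T|·Σ_x|φ′(x)|²)`
(`|u − v|² ≤ 2|u|² + 2|v|²` factorwise and `norm_avgQ14_sq_le`). [cite: Balaban1982Higgs1, (2.5) p.608, (2.10) p.609] -/
theorem kernel14_ge {κ : ℝ} (hκ : κ = prec (B1.aSeq D.a P.L k) (P.mesh k) P.d) (hκpos : 0 < κ)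
    (Ak : HiggsLattice.VecField P 0) (e' : ℝ) (A' : (j : Fin k) → HiggsLattice.VecField P j)
    (φ : HiggsLattice.ScalarField P k N) (φΩ : ↥D.Ω → EuclideanSpace ℝ (Fin N)) :
    ((κ / (2 * Real.pi)) ^ ((Module.finrank ℝ (EuclideanSpace ℝ (Fin N)) : ℝ) / 2)) ^ Fintype.card ↥D.Ωk
        * Real.exp (-(κ * ∑ y : ↥D.Ωk, ‖φ y.1‖ ^ 2))
        * Real.exp (-(κ * Fintype.card ↥D.Ωk * ((((P.L : ℝ) ^ (k * P.d))⁻¹) ^ 2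
            * (Fintype.card (HiggsLattice.Site P 0) * sqSum (extendZero D.Ω φΩ)))))
      ≤ D.kernel14 Ak e' A' φ φΩ := by
  set φ' := extendZero D.Ω φΩ with hφ'
  set c : ℝ := (κ / (2 * Real.pi)) ^ ((Module.finrank ℝ (EuclideanSpace ℝ (Fin N)) : ℝ) / 2) with hc
  set B : ℝ := (((P.L : ℝ) ^ (k * P.d))⁻¹) ^ 2 * (Fintype.card (HiggsLattice.Site P 0) * sqSum φ') with hB
  have hc0 : 0 < c := Real.rpow_pos_of_pos (by positivity) _
  -- factorwise lower bound
  have hfac : ∀ y : ↥D.Ωk, c * Real.exp (-(κ * ‖φ y.1‖ ^ 2)) * Real.exp (-(κ * B))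
      ≤ rtKernel κ (φ y.1 - D.avgQ14 Ak e' A' φ' y.1) := by
    intro y
    rw [rtKernel_eq, mul_assoc, ← Real.exp_add]
    refine mul_le_mul_of_nonneg_left ?_ hc0.le
    rw [Real.exp_le_exp]
    have hsq : ‖φ y.1 - D.avgQ14 Ak e' A' φ' y.1‖ ^ 2 ≤ 2 * ‖φ y.1‖ ^ 2 + 2 * ‖D.avgQ14 Ak e' A' φ' y.1‖ ^ 2 := by
      have h1 : ‖φ y.1 - D.avgQ14 Ak e' A' φ' y.1‖ ≤ ‖φ y.1‖ + ‖D.avgQ14 Ak e' A' φ' y.1‖ := norm_sub_le _ _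
      have h2 := pow_le_pow_left₀ (norm_nonneg _) h1 2
      nlinarith [sq_nonneg (‖φ y.1‖ - ‖D.avgQ14 Ak e' A' φ' y.1‖)]
    have hQ := norm_avgQ14_sq_le D Ak e' A' φ' y.1
    nlinarith [hκpos.le]
  have hfac0 : ∀ y : ↥D.Ωk, 0 ≤ c * Real.exp (-(κ * ‖φ y.1‖ ^ 2)) * Real.exp (-(κ * B)) :=
    fun y => by positivity
  rw [Data14.kernel14_eq, ← hκ, ← hφ']
  calc c ^ Fintype.card ↥D.Ωk * Real.exp (-(κ * ∑ y : ↥D.Ωk, ‖φ y.1‖ ^ 2))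
        * Real.exp (-(κ * Fintype.card ↥D.Ωk * B))
      = ∏ y : ↥D.Ωk, c * Real.exp (-(κ * ‖φ y.1‖ ^ 2)) * Real.exp (-(κ * B)) := by
        rw [Finset.prod_mul_distrib, Finset.prod_mul_distrib, Finset.prod_const, Finset.card_univ,
          ← Real.exp_sum, ← Real.exp_sum, Finset.sum_const, Finset.card_univ, nsmul_eq_mul, Finset.mul_sum,
          Finset.sum_neg_distrib]
        ring_nf
    _ ≤ ∏ y : ↥D.Ωk, rtKernel κ (φ y.1 - D.avgQ14 Ak e' A' φ' y.1) :=
        Finset.prod_le_prod (fun y _ => hfac0 y) fun y _ => hfac y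


/-! ## 2. The located defect: for `λ′ < 0` the fibre integral of (1.4) diverges, so the typed `E_k` is `0` there -/

/-- The precision `κ = a_k(L^kη)^{d−2}` of the kernel (I.2.10) is positive for `a > 0`, `L > 1`, `k ≥ 1`.
[cite: Balaban1982Higgs1, (2.15) p.609] -/
theorem prec_pos (ha : 0 < D.a) (hL : 1 < (P.L : ℝ)) (hk : 1 ≤ k) : 0 < prec (B1.aSeq D.a P.L k) (P.mesh k) P.d := by
  unfold prec
  exact mul_pos (B1.aSeq_pos ha hL hk) (zpow_pos (P.mesh_pos k) _)

/-- A fibre `ι → ℝ^N` (`ι` non-empty, `N ≥ 1`) has infinite Lebesgue measure. [folklore] -/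
private theorem volume_pi_univ_eq_top (hN : 1 ≤ N) {ι : Type} [Fintype ι] [Nonempty ι] :
    (volume : Measure (ι → EuclideanSpace ℝ (Fin N))) univ = ⊤ := by
  haveI : Nonempty (Fin N) := ⟨⟨0, hN⟩⟩
  exact measure_univ_of_isAddLeftInvariant _

/-- **THE LOCATED DEFECT (kernel form).**  For `N ≥ 1`, a non-degenerate kernel (`κ = a_k(L^kη)^{d−2} > 0`), a
positive running quartic coupling `λ(L^kε) > 0`, a site `x₀ ∈ Ω ∩ Ω₁` and a NEGATIVE bookkeeping parameter
`λ′ < 0`, the integrand `t(Ω; φ, φ′)·exp[…](φ′)` of `T^η[Ω, exp[…]](φ)` in (1.4) is NOT integrable over the fibre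
`φ′↾_Ω ∈ (Ω → ℝ^N)`: the term `−λ′λ(L^kε)Σ_{x∈Ω₁}η^d|φ′(x)|⁴` is then a POSITIVE quartic, which beats the Gaussian
kernel, the (bounded, `siteInner_scalarOp_le`) quadratic form and the counterterms along the `x₀`-fibre
(`density14_ge`, `kernel14_ge`); an integrable function on `(Ω∖{x₀} → ℝ^N) × ({x₀} → ℝ^N)` would have an integrable
`x₀`-section, but that section dominates a positive constant on an infinite-measure fibre.
[cite: Balaban1983Higgs3, (1.4) p.412] -/
theorem not_integrable_kernel14_mul_density14 (hN : 1 ≤ N)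
    (hκ : 0 < prec (B1.aSeq D.a P.L k) (P.mesh k) P.d) {lam' : ℝ} (hlam : lam' < 0) (hrun : 0 < D.lamRun)
    {x₀ : HiggsLattice.Site P 0} (hx₀Ω : x₀ ∈ D.Ω) (hx₀1 : x₀ ∈ D.Ω₁)
    (Ak : HiggsLattice.VecField P 0) (e' : ℝ) (A' : (j : Fin k) → HiggsLattice.VecField P j)
    (φ : HiggsLattice.ScalarField P k N) :
    ¬ Integrable (fun φΩ : ↥D.Ω → EuclideanSpace ℝ (Fin N) =>
        D.kernel14 Ak e' A' φ φΩ * D.density14 Ak e' lam' A' (extendZero D.Ω φΩ)) := by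
  intro h
  -- the constants of the lower bound
  set κ : ℝ := prec (B1.aSeq D.a P.L k) (P.mesh k) P.d with hκdef
  set c4 : ℝ := (-lam') * D.lamRun * P.mesh 0 ^ P.d with hc4
  have hc4pos : 0 < c4 := mul_pos (mul_pos (neg_pos.2 hlam) hrun) (pow_pos (P.mesh_pos 0) _)
  set C₁ : ℝ := κ * Fintype.card ↥D.Ωk * ((((P.L : ℝ) ^ (k * P.d))⁻¹) ^ 2
    * Fintype.card (HiggsLattice.Site P 0)) with hC₁
  set C₂ : ℝ := ((4 * P.d * (P.mesh 0)⁻¹ ^ 2 + |D.m2| * D.ell ^ 2) * P.mesh 0 ^ P.d) / 2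
    + (P.mesh 0 ^ P.d * D.ell ^ 2 * ∑ x ∈ D.Ω₁, |D.dm2 e' lam' x|) / 2 with hC₂
  set K₁ : ℝ := ((κ / (2 * Real.pi)) ^ ((Module.finrank ℝ (EuclideanSpace ℝ (Fin N)) : ℝ) / 2))
      ^ Fintype.card ↥D.Ωk * Real.exp (-(κ * ∑ y : ↥D.Ωk, ‖φ y.1‖ ^ 2)) with hK₁
  have hK₁pos : 0 < K₁ := mul_pos (pow_pos (Real.rpow_pos_of_pos (by positivity) _) _) (Real.exp_pos _)
  set C : ℝ := C₁ + C₂ with hC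
  -- the lower bound of the integrand by a function of the coordinates `x ≠ x₀` alone
  have hF : ∀ φΩ : ↥D.Ω → EuclideanSpace ℝ (Fin N),
      K₁ * Real.exp (-(C ^ 2 / (4 * c4)) - D.E1 e' lam')
          * Real.exp (-(C * ∑ x ∈ Finset.univ.erase x₀, ‖extendZero D.Ω φΩ x‖ ^ 2))
        ≤ D.kernel14 Ak e' A' φ φΩ * D.density14 Ak e' lam' A' (extendZero D.Ω φΩ) := by
    intro φΩ
    set φ' := extendZero D.Ω φΩ with hφ'
    set S' : ℝ := ∑ x ∈ Finset.univ.erase x₀, ‖φ' x‖ ^ 2 with hS'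
    have hsplit : sqSum φ' = ‖φ' x₀‖ ^ 2 + S' := by
      rw [sqSum, ← Finset.add_sum_erase _ _ (Finset.mem_univ x₀)]
    have hk := kernel14_ge D hκdef hκ Ak e' A' φ φΩ
    have hd := density14_ge D Ak e' lam' A' hlam.le hrun.le hx₀1 φ'
    have hk0 : 0 ≤ K₁ * Real.exp (-(C₁ * sqSum φ')) := by positivity
    have hkern : K₁ * Real.exp (-(C₁ * sqSum φ')) ≤ D.kernel14 Ak e' A' φ φΩ := by
      have e1 : -(κ * Fintype.card ↥D.Ωk * ((((P.L : ℝ) ^ (k * P.d))⁻¹) ^ 2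
          * (Fintype.card (HiggsLattice.Site P 0) * sqSum (extendZero D.Ω φΩ)))) = -(C₁ * sqSum φ') := by
        rw [hC₁, hφ']; ring
      rw [← e1]; exact hk
    have hdens : Real.exp (c4 * ‖φ' x₀‖ ^ 4 - C₂ * sqSum φ' - D.E1 e' lam') ≤ D.density14 Ak e' lam' A' φ' := by
      have e2 : (-lam') * D.lamRun * P.mesh 0 ^ P.d * ‖φ' x₀‖ ^ 4 = c4 * ‖φ' x₀‖ ^ 4 := by rw [hc4]
      rw [← e2]; exact hd
    have hprod := mul_le_mul hkern hdens (Real.exp_pos _).le (hk0.trans hkern)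
    have hq := quartic_lower' hc4pos C ‖φ' x₀‖
    have hexp : Real.exp (-(C ^ 2 / (4 * c4)) - D.E1 e' lam') * Real.exp (-(C * S'))
        ≤ Real.exp (-(C₁ * sqSum φ')) * Real.exp (c4 * ‖φ' x₀‖ ^ 4 - C₂ * sqSum φ' - D.E1 e' lam') := by
      rw [← Real.exp_add, ← Real.exp_add, Real.exp_le_exp, hsplit, hC]
      nlinarith [hq]
    calc K₁ * Real.exp (-(C ^ 2 / (4 * c4)) - D.E1 e' lam') * Real.exp (-(C * S'))
        = K₁ * (Real.exp (-(C ^ 2 / (4 * c4)) - D.E1 e' lam') * Real.exp (-(C * S'))) := by ring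
      _ ≤ K₁ * (Real.exp (-(C₁ * sqSum φ')) * Real.exp (c4 * ‖φ' x₀‖ ^ 4 - C₂ * sqSum φ' - D.E1 e' lam')) :=
          mul_le_mul_of_nonneg_left hexp hK₁pos.le
      _ = K₁ * Real.exp (-(C₁ * sqSum φ')) * Real.exp (c4 * ‖φ' x₀‖ ^ 4 - C₂ * sqSum φ' - D.E1 e' lam') := by ring
      _ ≤ D.kernel14 Ak e' A' φ φΩ * D.density14 Ak e' lam' A' φ' := hprod
  -- split the fibre at `x₀`
  set x₀' : ↥D.Ω := ⟨x₀, hx₀Ω⟩ with hx₀'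
  set p : ↥D.Ω → Prop := fun x => x ≠ x₀' with hp
  set e := MeasurableEquiv.piEquivPiSubtypeProd (fun _ : ↥D.Ω => EuclideanSpace ℝ (Fin N)) p with he
  have hpres : MeasurePreserving e volume volume :=
    volume_preserving_piEquivPiSubtypeProd (fun _ : ↥D.Ω => EuclideanSpace ℝ (Fin N)) p
  have h1 : Integrable ((fun φΩ : ↥D.Ω → EuclideanSpace ℝ (Fin N) =>
      D.kernel14 Ak e' A' φ φΩ * D.density14 Ak e' lam' A' (extendZero D.Ω φΩ)) ∘ e.symm)
      (volume : Measure (({x // p x} → EuclideanSpace ℝ (Fin N)) × ({x // ¬ p x} → EuclideanSpace ℝ (Fin N)))) :=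
    ((hpres.symm e).integrable_comp_emb e.symm.measurableEmbedding).2 h
  rw [Measure.volume_eq_prod] at h1
  have hae := ((integrable_prod_iff h1.aestronglyMeasurable).1 h1).1
  -- the first factor carries a non-zero measure, so some section is integrable
  have hne0 : (volume : Measure ({x // p x} → EuclideanSpace ℝ (Fin N))) ≠ 0 := by
    intro h0
    have hpos := IsOpen.measure_pos (volume : Measure ({x // p x} → EuclideanSpace ℝ (Fin N))) isOpen_univ
      univ_nonempty
    rw [h0] at hpos
    simp at hpos
  haveI : (ae (volume : Measure ({x // p x} → EuclideanSpace ℝ (Fin N)))).NeBot := ae_neBot.2 hne0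
  obtain ⟨a, ha⟩ := hae.exists
  -- along the `x₀`-fibre the lower bound is a positive constant
  set b₀ : {x // ¬ p x} → EuclideanSpace ℝ (Fin N) := fun _ => 0 with hb₀
  have hind : ∀ b : {x // ¬ p x} → EuclideanSpace ℝ (Fin N),
      (∑ x ∈ Finset.univ.erase x₀, ‖extendZero D.Ω (e.symm (a, b)) x‖ ^ 2)
        = ∑ x ∈ Finset.univ.erase x₀, ‖extendZero D.Ω (e.symm (a, b₀)) x‖ ^ 2 := by
    intro b
    refine Finset.sum_congr rfl fun x hx => ?_
    have hxne : x ≠ x₀ := Finset.ne_of_mem_erase hx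
    by_cases hxΩ : x ∈ D.Ω
    · have hpx : p ⟨x, hxΩ⟩ := fun hh => hxne (congrArg Subtype.val hh)
      rw [extendZero_of_mem _ _ hxΩ, extendZero_of_mem _ _ hxΩ]
      simp [he, MeasurableEquiv.piEquivPiSubtypeProd_symm_apply, hpx]
    · rw [extendZero_of_not_mem _ _ hxΩ, extendZero_of_not_mem _ _ hxΩ]
  set Ka : ℝ := K₁ * Real.exp (-(C ^ 2 / (4 * c4)) - D.E1 e' lam')
      * Real.exp (-(C * ∑ x ∈ Finset.univ.erase x₀, ‖extendZero D.Ω (e.symm (a, b₀)) x‖ ^ 2)) with hKa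
  have hKapos : 0 < Ka := by positivity
  have hconst : Integrable (fun _ : {x // ¬ p x} → EuclideanSpace ℝ (Fin N) => Ka)
      (volume : Measure ({x // ¬ p x} → EuclideanSpace ℝ (Fin N))) := by
    refine ha.mono' aestronglyMeasurable_const (Filter.Eventually.of_forall fun b => ?_)
    rw [Real.norm_eq_abs, abs_of_pos hKapos, hKa, ← hind b]
    exact hF (e.symm (a, b))
  have hfin : IsFiniteMeasure (volume : Measure ({x // ¬ p x} → EuclideanSpace ℝ (Fin N))) :=
    (integrable_const_iff_isFiniteMeasure hKapos.ne').1 hconst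
  haveI : Nonempty {x // ¬ p x} := ⟨⟨x₀', by simp [hp]⟩⟩
  have hlt : (volume : Measure ({x // ¬ p x} → EuclideanSpace ℝ (Fin N))) univ < ⊤ := by
    haveI := hfin; exact measure_lt_top _ _
  rw [volume_pi_univ_eq_top hN] at hlt
  exact lt_irrefl _ hlt


/-- **`λ′ < 0`: the renormalization transformation applied to the density of (1.4) has Lebesgue value `0`**
(`T^η[Ω, exp[…]](φ) = 0` for every fluctuation family `A′` and every `φ`; Lean's convention for a non-integrable
integrand). [cite: Balaban1983Higgs3, (1.4) p.412] -/
theorem rt14_density14_eq_zero_of_neg (hN : 1 ≤ N) (hκ : 0 < prec (B1.aSeq D.a P.L k) (P.mesh k) P.d)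
    {lam' : ℝ} (hlam : lam' < 0) (hrun : 0 < D.lamRun) {x₀ : HiggsLattice.Site P 0} (hx₀Ω : x₀ ∈ D.Ω)
    (hx₀1 : x₀ ∈ D.Ω₁) (Ak : HiggsLattice.VecField P 0) (e' : ℝ) (A' : (j : Fin k) → HiggsLattice.VecField P j)
    (φ : HiggsLattice.ScalarField P k N) :
    D.rt14 Ak e' A' (D.density14 Ak e' lam' A') φ = 0 := by
  rw [Data14.rt14_eq]
  exact integral_undef (not_integrable_kernel14_mul_density14 D hN hκ hlam hrun hx₀Ω hx₀1 Ak e' A' φ)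

/-- **`λ′ < 0`: the typed `E_k(e′, λ′, Ω, A^{(k)}, φ)` of (1.4) is `0`** (`−log ∫ 0 = −log 0 = 0`), for every `e′`,
`A^{(k)}`, `φ` — under `N ≥ 1`, a non-degenerate kernel, `λ(L^kε) > 0` and `Ω ∩ Ω₁ ≠ ∅`.
[cite: Balaban1983Higgs3, (1.4) p.412] -/
theorem auxE_eq_zero_of_neg (hN : 1 ≤ N) (hκ : 0 < prec (B1.aSeq D.a P.L k) (P.mesh k) P.d)
    {lam' : ℝ} (hlam : lam' < 0) (hrun : 0 < D.lamRun) {x₀ : HiggsLattice.Site P 0} (hx₀Ω : x₀ ∈ D.Ω)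
    (hx₀1 : x₀ ∈ D.Ω₁) (e' : ℝ) (Ak : HiggsLattice.VecField P 0) (φ : HiggsLattice.ScalarField P k N) :
    D.auxE e' lam' Ak φ = 0 := by
  rw [Data14.auxE_eq]
  simp only [rt14_density14_eq_zero_of_neg D hN hκ hlam hrun hx₀Ω hx₀1, integral_zero, Real.log_zero, neg_zero]

/-! ## 3. The finding: every `β ≥ 1` term of the typed concrete (1.5) vanishes -/

/-- If `g = 0` on `(−∞, 0)` then Lean's two-sided `deriv g 0 = 0` (`deriv` is `0` at a point of non-differentiability;
a differentiable such `g` has derivative `0` by uniqueness within `Iio 0`). [folklore] -/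
private theorem deriv_eq_zero_of_eqOn_Iio {g : ℝ → ℝ} (hg : ∀ x < 0, g x = 0) : deriv g 0 = 0 := by
  by_cases hd : DifferentiableAt ℝ g 0
  · have hev : g =ᶠ[𝓝[Iio 0] 0] fun _ => (0 : ℝ) := by
      filter_upwards [self_mem_nhdsWithin] with x hx using hg x hx
    have h0 : g 0 = 0 := by
      have h1 : Tendsto g (𝓝[Iio 0] 0) (𝓝 (g 0)) := hd.continuousAt.continuousWithinAt.tendsto
      have h2 : Tendsto g (𝓝[Iio 0] 0) (𝓝 0) := (tendsto_const_nhds (x := (0 : ℝ))).congr' hev.symm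
      exact tendsto_nhds_unique h1 h2
    have hw : HasDerivWithinAt g (deriv g 0) (Iio 0) 0 := hd.hasDerivAt.hasDerivWithinAt
    have hw0 : HasDerivWithinAt g 0 (Iio 0) 0 :=
      (hasDerivWithinAt_const (0 : ℝ) (Iio 0) (0 : ℝ)).congr_of_eventuallyEq hev (by simp [h0])
    exact (uniqueDiffWithinAt_Iio 0).eq_deriv _ hw hw0
  · exact deriv_zero_of_not_differentiableAt hd

/-- If `g = 0` on `(−∞, 0)` then `iteratedDeriv n g 0 = 0` for every `n ≥ 1`. [folklore] -/
private theorem iteratedDeriv_eq_zero_of_eqOn_Iio {g : ℝ → ℝ} (hg : ∀ x < 0, g x = 0) {n : ℕ} (hn : 1 ≤ n) :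
    iteratedDeriv n g 0 = 0 := by
  obtain ⟨m, rfl⟩ := Nat.exists_eq_add_of_le' hn
  rw [iteratedDeriv_succ]
  apply deriv_eq_zero_of_eqOn_Iio
  intro x hx
  have hev : g =ᶠ[𝓝 x] fun _ => (0 : ℝ) := by
    filter_upwards [Iio_mem_nhds hx] with y hy using hg y hy
  rw [hev.iteratedDeriv_eq]
  simp

/-- **THE FINDING (kernel form).**  Under the same hypotheses, for every `e′` and every `β ≥ 1`:
`iteratedDeriv β (λ′ ↦ E_k(e′, λ′, Ω, A^{(k)}, φ)) 0 = 0` — all two-sided iterated `λ′`-derivatives at `0` of the typed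
`E_k` vanish. [cite: Balaban1983Higgs3, (1.4)–(1.5) p.412] -/
theorem iteratedDeriv_auxE_lam_eq_zero (hN : 1 ≤ N) (hκ : 0 < prec (B1.aSeq D.a P.L k) (P.mesh k) P.d)
    (hrun : 0 < D.lamRun) {x₀ : HiggsLattice.Site P 0} (hx₀Ω : x₀ ∈ D.Ω) (hx₀1 : x₀ ∈ D.Ω₁) (e' : ℝ)
    (Ak : HiggsLattice.VecField P 0) (φ : HiggsLattice.ScalarField P k N) {β : ℕ} (hβ : 1 ≤ β) :
    iteratedDeriv β (fun lam' => D.auxE e' lam' Ak φ) 0 = 0 :=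
  iteratedDeriv_eq_zero_of_eqOn_Iio (fun _ hx => auxE_eq_zero_of_neg D hN hκ hx hrun hx₀Ω hx₀1 e' Ak φ) hβ

/-- **Consequence for the typed interaction (1.5).**  Under the same hypotheses `interaction15 n̄ A^{(k)} φ` —
r15's `pert15` (two-sided `iteratedDeriv` in `λ′`) of the typed `E_k` — EQUALS its `β = 0` sub-sum: no term of (1.5)
with a `λ′`-derivative survives; in particular the `φ⁴` vertex (1.6) and every other `λ`-vertex of the effective
interaction are absent from the typed `𝒫^{(k)}`. [cite: Balaban1983Higgs3, (1.5)–(1.6) pp.412–413] -/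
theorem interaction15_eq_sum_beta_zero (hN : 1 ≤ N) (hκ : 0 < prec (B1.aSeq D.a P.L k) (P.mesh k) P.d)
    (hrun : 0 < D.lamRun) {x₀ : HiggsLattice.Site P 0} (hx₀Ω : x₀ ∈ D.Ω) (hx₀1 : x₀ ∈ D.Ω₁) (nbar : ℕ)
    (Ak : HiggsLattice.VecField P 0) (φ : HiggsLattice.ScalarField P k N) :
    D.interaction15 nbar Ak φ
      = ∑ ab ∈ B3Sect1Counterterms.idx15 nbar,
          if ab.2 = 0 then
            1 / ((ab.1.factorial : ℝ) * ((0 : ℕ).factorial : ℝ)) * iteratedDeriv ab.1 (fun e' => D.auxE e' 0 Ak φ) 0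
          else 0 := by
  unfold Data14.interaction15 B3Sect1Counterterms.pert15
  refine Finset.sum_congr rfl fun ab _ => ?_
  by_cases hb : ab.2 = 0
  · simp only [hb, iteratedDeriv_zero, if_true]
  · have hb1 : 1 ≤ ab.2 := Nat.one_le_iff_ne_zero.2 hb
    have hin : (fun e' => iteratedDeriv ab.2 (fun l' => D.auxE e' l' Ak φ) 0) = fun _ => (0 : ℝ) :=
      funext fun e' => iteratedDeriv_auxE_lam_eq_zero D hN hκ hrun hx₀Ω hx₀1 e' Ak φ hb1
    rw [hin, if_neg hb]
    simp

/-! ## 4. What the print denotes: the repaired, one-sided concrete instance of (1.5) -/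

/-- **(1.5), ONE-SIDED READING at the typed `E_k` (1.4)** — the typer's repaired concrete instance: the `λ′`-derivatives
taken WITHIN `[0, ∞)` at `0` (`iteratedDerivWithin β · (Set.Ici 0) 0`; the perturbation expansion never differentiates
at `λ′ < 0`, where the integral (1.4) diverges), the `e′`-derivatives two-sided as printed, inner variable `λ′`, outer
`e′` (the convention of r01's `B1Sect1Statements.ModelData.e1R`).  r15's generic two-sided sum `pert15` is unchanged;
this is the instance of record proposed for the CONCRETE (1.5). [cite: Balaban1983Higgs3, (1.5) p.412] -/
noncomputable def interaction15R (nbar : ℕ) (Ak : HiggsLattice.VecField P 0) (φ : HiggsLattice.ScalarField P k N) : ℝ :=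
  ∑ ab ∈ B3Sect1Counterterms.idx15 nbar,
    1 / ((ab.1.factorial : ℝ) * (ab.2.factorial : ℝ)) *
      iteratedDeriv ab.1 (fun e' => iteratedDerivWithin ab.2 (fun l' => D.auxE e' l' Ak φ) (Set.Ici 0) 0) 0

/-- dictionary: the `β = 0` terms of `interaction15R` and of `interaction15` agree (`iteratedDerivWithin 0 = id =
iteratedDeriv 0`); the two differ exactly in the `β ≥ 1` terms. [cite: Balaban1983Higgs3, (1.5) p.412] -/
theorem interaction15R_term_beta_zero (Ak : HiggsLattice.VecField P 0) (φ : HiggsLattice.ScalarField P k N) (α : ℕ) :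
    iteratedDeriv α (fun e' => iteratedDerivWithin 0 (fun l' => D.auxE e' l' Ak φ) (Set.Ici 0) 0) 0
      = iteratedDeriv α (fun e' => iteratedDeriv 0 (fun l' => D.auxE e' l' Ak φ) 0) 0 := by
  simp only [iteratedDerivWithin_zero, iteratedDeriv_zero]

/-- **repaired (1.5) versus repaired (I.3.62).**  `interaction15R = [r12's one-sided perturbative sum `pertSum362R` of
`E_k` at e = λ = 1] − E_k(0, 0)` — the one-sided twin of g4's `interaction15_eq` (r15's `pert15_eq_pertSum362_sub`):
the `(0, 0)` Taylor term is the value of the generating function and all other terms coincide.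
[cite: Balaban1983Higgs3, (1.5) p.412] -/
theorem interaction15R_eq_pertSum362R_sub (nbar : ℕ) (Ak : HiggsLattice.VecField P 0)
    (φ : HiggsLattice.ScalarField P k N) :
    interaction15R D nbar Ak φ
      = B1Sect3Statements.pertSum362R (fun e' lam' => D.auxE e' lam' Ak φ) 1 1 nbar - D.auxE 0 0 Ak φ := by
  have hmem : ((0 : ℕ), (0 : ℕ)) ∈ ((Finset.range (nbar + 1) ×ˢ Finset.range (nbar + 1)).filter
      fun ab => ab.1 + ab.2 ≤ nbar) := by
    simp
  rw [interaction15R, B3Sect1Counterterms.idx15_eq_erase, B1Sect3Statements.pertSum362R, ← Finset.sum_erase_add _ _ hmem]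
  simp only [one_pow, mul_one, Nat.factorial_zero, Nat.cast_one, iteratedDeriv_zero, iteratedDerivWithin_zero, one_div,
    inv_one, one_mul]
  ring

/-- With `n̄ = 0` the repaired interaction is the empty sum as well. [cite: Balaban1983Higgs3, (1.5) p.412] -/
theorem interaction15R_zero (Ak : HiggsLattice.VecField P 0) (φ : HiggsLattice.ScalarField P k N) :
    interaction15R D 0 Ak φ = 0 := by
  have h : B3Sect1Counterterms.idx15 0 = ∅ := by
    ext ⟨a, b⟩
    simp only [B3Sect1Counterterms.idx15, Finset.mem_filter, Finset.mem_product, Finset.mem_range,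
      Finset.notMem_empty, iff_false]
    omega
  simp [interaction15R, h]


/-! ## 5. (v1.1, append-only) Re-threading over r15's generic one-sided `B3Sect1Counterterms.pert15R` (v1.1 p333998):
`interaction15R` IS its instance at the typed `E_k`; what the one-sided instance ignores, when the two instances agree,
and by what they differ under the audit hypotheses -/

/-- **`interaction15R` = r15's generic one-sided (1.5) `pert15R` at the typed `E_k` of (1.4)**, summand by summand
(`rfl`): the decl-of-record chain is `pert15R` (generic, r15) → `interaction15R` (concrete, this file).
[cite: Balaban1983Higgs3, (1.5) p.412] -/
theorem interaction15R_eq_pert15R (nbar : ℕ) (Ak : HiggsLattice.VecField P 0) (φ : HiggsLattice.ScalarField P k N) :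
    interaction15R D nbar Ak φ = B3Sect1Counterterms.pert15R (fun e' l' => D.auxE e' l' Ak φ) nbar := rfl

/-- **The repaired instance does not see the junk region `λ′ < 0`**: two data of (1.4) whose typed `E_k` agree on the
physical half-plane `λ′ ≥ 0` (all `e′`; fields fixed) have the same repaired interaction — whatever Lebesgue values
their `E_k` carry on `λ′ < 0` (there: `0`, `auxE_eq_zero_of_neg`).  From r15's `pert15R_congr_Ici`.
[cite: Balaban1983Higgs3, (1.5) p.412] -/
theorem interaction15R_congr_Ici {D D' : Data14 P N k} {Ak : HiggsLattice.VecField P 0}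
    {φ : HiggsLattice.ScalarField P k N} (h : ∀ e' l', 0 ≤ l' → D.auxE e' l' Ak φ = D'.auxE e' l' Ak φ) (nbar : ℕ) :
    interaction15R D nbar Ak φ = interaction15R D' nbar Ak φ := by
  rw [interaction15R_eq_pert15R, interaction15R_eq_pert15R]
  exact B3Sect1Counterterms.pert15R_congr_Ici h nbar

/-- **When the two instances agree**: IF for every `e′` the typed `λ′ ↦ E_k(e′, λ′, Ω, A^{(k)}, φ)` were `C^β` at
`λ′ = 0` TWO-SIDEDLY for all `β ≤ n̄`, then `interaction15R = interaction15` (r15's `pert15R_eq_pert15`).  Under the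
audit hypotheses of §2–§3 this premise FAILS for `n̄ ≥ 1` as soon as some one-sided `λ′`-derivative of `E_k` at `0⁺` is
non-zero (the two-sided ones all vanish, `iteratedDeriv_auxE_lam_eq_zero`) — recorded here only to make the logical
relation between g4's instance and the repaired one explicit. [cite: Balaban1983Higgs3, (1.5) p.412] -/
theorem interaction15R_eq_interaction15_of_contDiffAt {nbar : ℕ} {Ak : HiggsLattice.VecField P 0}
    {φ : HiggsLattice.ScalarField P k N} (h : ∀ e', ∀ β ≤ nbar, ContDiffAt ℝ β (fun l' => D.auxE e' l' Ak φ) 0) :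
    interaction15R D nbar Ak φ = D.interaction15 nbar Ak φ := by
  rw [interaction15R_eq_pert15R, B3Sect1Counterterms.pert15R_eq_pert15 h]
  rfl

/-- **By what the two instances differ under the audit hypotheses**: for `N ≥ 1`, a non-degenerate kernel,
`λ(L^kε) > 0` and a site of `Ω ∩ Ω₁`, the repaired (one-sided) interaction minus g4's (two-sided) one is EXACTLY the
`β ≥ 1` part of the repaired sum — the whole `λ`-vertex content of (1.5) ((1.6) and every mixed `e′`/`λ′` term):
`interaction15R − interaction15 = Σ_{(α,β) ∈ idx15 n̄, β ≥ 1} (α!β!)⁻¹ ∂^α_{e′}|₀ ∂^β_{λ′,+}|₀ E_k`.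
[cite: Balaban1983Higgs3, (1.5)–(1.6) pp.412–413] -/
theorem interaction15R_sub_interaction15 (hN : 1 ≤ N) (hκ : 0 < prec (B1.aSeq D.a P.L k) (P.mesh k) P.d)
    (hrun : 0 < D.lamRun) {x₀ : HiggsLattice.Site P 0} (hx₀Ω : x₀ ∈ D.Ω) (hx₀1 : x₀ ∈ D.Ω₁) (nbar : ℕ)
    (Ak : HiggsLattice.VecField P 0) (φ : HiggsLattice.ScalarField P k N) :
    interaction15R D nbar Ak φ - D.interaction15 nbar Ak φ
      = ∑ ab ∈ B3Sect1Counterterms.idx15 nbar,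
          if ab.2 = 0 then 0
          else 1 / ((ab.1.factorial : ℝ) * (ab.2.factorial : ℝ)) *
            iteratedDeriv ab.1 (fun e' => iteratedDerivWithin ab.2 (fun l' => D.auxE e' l' Ak φ) (Set.Ici 0) 0) 0 := by
  rw [interaction15_eq_sum_beta_zero D hN hκ hrun hx₀Ω hx₀1 nbar Ak φ, interaction15R, ← Finset.sum_sub_distrib]
  refine Finset.sum_congr rfl fun ab _ => ?_
  by_cases hb : ab.2 = 0
  · simp only [hb, if_true, iteratedDerivWithin_zero, Nat.factorial_zero, sub_self]
  · rw [if_neg hb, if_neg hb, sub_zero]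

end SemanticAudit

end Literature.MathematicalPhysics.QuantumFieldTheory.Balaban1983to89.B3Eq15OneSidedInteraction
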